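import Summits.QuantumFields.BalabanUV.Beta.GAN24.NestedMultiplierWordLaw

/-!
# `BalabanUV.Beta.GAN24.PlantedWordLaw` — binder row G-an2-4 ∕ (CONV-C), routes C-R6° («VALUES») × R7 («TWO CURRENCIES»), PART 217:
# THE ONE-STEP AVERAGED LAW OF A WORD `G·D·W` FROM THE PLANTED LAWS OF ITS TWO ITEMS — `‖G′ − JGJᴴ‖ ≤ p_G`, `‖W′ − JWJᴴ‖ ≤ p_W` — AND A NESTED BOUNDED
# MULTIPLIER `D′J = JD` (no smoothness, no (H-bd), no (H-cons)): `‖ÃT′Ãᴴ − T‖ ≤ ακ′p_G + gαp_W + fακ + gαf_W`; along a tower `OneStepAveragedLaw` ∕ `TowerLimitRate`.  With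
# `G = 𝒢`, `W = ∇_μ𝒢` (both items of [B5] (1.89) have planted laws) and `D = diag(𝟙_B)` nested, this is the operator-currency step rate of the INDICATOR insertion word
# (census V202′ (b′)) modulo the two-level letters `p_W`, `f_W` (PART 218) (unit b2b-balaban-gan24-p3, gen 63; v1)

NOT IN PRINT; OUR PROOF ([folklore] finite-dimensional operator algebra in the `ℓ²`-operator norm; `Spine/CovariantAveragingTower` (`OneStepAveragedLaw`, `TowerLimitRate`,
`towerLimitRate_of_oneStepAveragedLaw`), `Spine/BackgroundResolventTower` (`FreeTowerLaws`, `opNorm_normalised_le`) BY NAME; [King1986] Lemma 4.5 (4.32) p. 674 «replace one by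
one every factor» is the printed pattern, method reference only; nothing printed is a hypothesis).
HONEST FRAMING (cell contract, verbatim): «discharging `BetaPertH` makes Bałaban's UV stability UNCONDITIONAL — a real constructive-QFT result; it is NOT the
continuum limit and NOT the Clay problem.»  HONEST DEPENDENCY (verbatim): «continuum YM on T⁴ ⇐ BetaPertH ∧ nine spine estimates (0/9 proved); BetaPertH ⇐
(D1) ∧ (D4) ∧ CAP+tail; G-an2-4 gates asym, D1 and NE2/3/4.»

WHY (census V202′ (b′), sharpening PART 216).  PART 216 removed the left (H-bd) letter from the word law but kept an injected defect of the derivative item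
`‖N′(G′J − JG)‖`, which is NOT small for a piecewise-constant injection (the fine derivative of an injected function lives on the block faces).  The right currency is the
PLANTED one: both items `G = 𝒢` and `W = ∇_μ𝒢` of [B5] (1.89) satisfy `‖X′ − JXJᴴ‖ = O(η)` (T4 `KingPairingPlantedLaw.opNorm_calG_sub_planted_le`; for `∇𝒢` from King's law
`B5G183RateTorusW.opNorm_Qavg_fdiff_calG_rate` + the two complement defects, PART 218), and a NESTED multiplier (`D′J = JD`: the indicator of a union of blocks, read one level up)
passes through the injection EXACTLY: `JᴴD′J = D`.  Then `T′ − JTJᴴ = (G′ − JGJᴴ)D′W′ + JGJᴴ·D′·(W′ − JWJᴴ)` — two planted defects times bounded factors — and the sandwich by the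
normalised averaging costs only the pairing letters `‖FG‖` and `‖WFᴴ‖`.  NO smoothness of `D`, NO (H-bd), NO (H-cons).

WHAT THIS FILE PROVES (0 sorry, 0 `def`, nothing cited; `G, D, W, F : n × n`, `G′, D′, W′ : m × m`, `J : m × n`, `Ã : n × m` ANY complex matrices):
* §1 **`planted_word_eq`** (EXACT; `JᴴJ = 1`, `D′J = JD`): `G′D′W′ − J(GDW)Jᴴ = (G′ − JGJᴴ)D′W′ + JGJᴴ·D′·(W′ − JWJᴴ)`; `sandwich_eq` (EXACT; `ÃJ = 1 + F`):
  `ÃT′Ãᴴ − T = Ã(T′ − JTJᴴ)Ãᴴ + (FG)(DW)(ÃJ)ᴴ + GD(WFᴴ)`.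
* §2 **`opNorm_planted_word_sandwich_le`**: `‖G‖ ≤ g`, `‖D‖, ‖D′‖ ≤ α`, `‖W‖ ≤ κ`, `‖W′‖ ≤ κ`, `‖Ã‖, ‖J‖ ≤ 1`, `JᴴJ = 1`, `ÃJ = 1 + F`, `D′J = JD`, `‖G′ − JGJᴴ‖ ≤ p_G`, `‖W′ − JWJᴴ‖ ≤ p_W`,
  `‖FG‖ ≤ f`, `‖WFᴴ‖ ≤ f_W` ⟹ `‖Ã(G′D′W′)Ãᴴ − GDW‖ ≤ ακ·p_G + gα·p_W + f·(ακ) + gα·f_W`.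
* §3 ALONG A TOWER (`FreeTowerLaws Δ A J F r e₀ e₁ f` for `Ã, J, F, f`; the other letters displayed): **`oneStepAveragedLaw_plantedWord`**, **`towerLimitRate_plantedWord`**
  (`TowerLimitRate A r (k ↦ Δ_k⁻¹D_kW_k) (ακC_G + gαC_W + ακC_f + gαC_{fW}) ρ` from geometric letters `p_G ≤ C_Gρ^k`, `p_W ≤ C_Wρ^k`, `f ≤ C_fρ^k`, `f_W ≤ C_{fW}ρ^k`, `ρ < 1`).
WHAT IT DOES NOT DO: supply `p_W`, `f_W` for `(calDalev, QBlev, JpcT, fdiff)` (PART 218), the nesting of the indicator multipliers and the tower instance (PART 219); words with two insertions.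
SUPPLIER work; NEVER «G-an2-4 closed»; NOT (CONV-C), NOT D1, NOT `BetaPertH`, NOT continuum, NOT Clay.  Records: `HOME/b2b-balaban-gan24-p3/gen63/README.md`.
-/

noncomputable section

open scoped BigOperators ComplexConjugate Matrix Matrix.Norms.L2Operator
open Filter Topology

namespace Summit.QuantumFields.BalabanUV.Beta.GAN24.PlantedWordLaw

open Summit.QuantumFields.BalabanUV.T4Continuum
open Summit.QuantumFields.BalabanUV.T4Continuum.CovariantAveragingTower (OneStepAveragedLaw TowerLimitRate towerLimitRate_of_oneStepAveragedLaw)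
open Summit.QuantumFields.BalabanUV.T4Continuum.BackgroundResolventTower (FreeTowerLaws opNorm_normalised_le)

/-! ## §1 The exact identities -/

section TwoLevel

variable {m n : Type*} [Fintype m] [DecidableEq m] [Fintype n] [DecidableEq n]
variable {G D W : Matrix n n ℂ} {G' D' W' : Matrix m m ℂ} {J : Matrix m n ℂ}

omit [DecidableEq m] in
/-- **`planted_word_eq` — THE PLANTED DEFECT OF THE WORD IS THE SUM OF THE TWO ITEMS' PLANTED DEFECTS** (EXACT): with `JᴴJ = 1` and the NESTING `D′J = JD`,
`G′D′W′ − J(GDW)Jᴴ = (G′ − JGJᴴ)·D′W′ + JGJᴴ·D′·(W′ − JWJᴴ)` (the cross term `JGJᴴD′JWJᴴ = JG(JᴴJ)DWJᴴ = JGDWJᴴ`). [our proof] -/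
theorem planted_word_eq (hJJ : Jᴴ * J = 1) (hnest : D' * J = J * D) :
    G' * D' * W' - J * (G * D * W) * Jᴴ = (G' - J * G * Jᴴ) * (D' * W') + J * G * Jᴴ * D' * (W' - J * W * Jᴴ) := by
  have key : J * G * Jᴴ * D' * (J * W * Jᴴ) = J * (G * D * W) * Jᴴ := by
    calc J * G * Jᴴ * D' * (J * W * Jᴴ) = J * G * (Jᴴ * (D' * J)) * W * Jᴴ := by simp only [Matrix.mul_assoc]
      _ = J * G * (Jᴴ * (J * D)) * W * Jᴴ := by rw [hnest]
      _ = J * G * ((Jᴴ * J) * D) * W * Jᴴ := by simp only [Matrix.mul_assoc]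
      _ = J * (G * D * W) * Jᴴ := by rw [hJJ, Matrix.one_mul]; simp only [Matrix.mul_assoc]
  rw [Matrix.sub_mul, Matrix.mul_sub, key]
  simp only [Matrix.mul_assoc]
  abel

omit [DecidableEq m] in
/-- **`sandwich_eq` — THE SANDWICH IDENTITY WITH THE PAIRING `ÃJ = 1 + F`** (EXACT): `T = GDW`, any `T′`:
`ÃT′Ãᴴ − T = Ã(T′ − JTJᴴ)Ãᴴ + (FG)(DW)(ÃJ)ᴴ + GD(WFᴴ)`. [our proof] -/
theorem sandwich_eq {At : Matrix n m ℂ} {F : Matrix n n ℂ} (hAJ : At * J = 1 + F) (T' : Matrix m m ℂ) :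
    At * T' * Atᴴ - G * D * W = At * (T' - J * (G * D * W) * Jᴴ) * Atᴴ + F * G * (D * W) * (At * J)ᴴ + G * D * (W * Fᴴ) := by
  set T : Matrix n n ℂ := G * D * W with hTdef
  have e2 : At * (J * T * Jᴴ) * Atᴴ = (At * J) * T * (At * J)ᴴ := by
    rw [Matrix.conjTranspose_mul]; simp only [Matrix.mul_assoc]
  have e : At * T' * Atᴴ - T = At * (T' - J * T * Jᴴ) * Atᴴ + F * T * (At * J)ᴴ + T * Fᴴ := by
    rw [Matrix.mul_sub, Matrix.sub_mul, e2, hAJ, Matrix.conjTranspose_add, Matrix.conjTranspose_one]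
    simp only [Matrix.add_mul, Matrix.mul_add, Matrix.one_mul, Matrix.mul_one]
    abel
  have eFT : F * T * (At * J)ᴴ = F * G * (D * W) * (At * J)ᴴ := by rw [hTdef]; simp only [Matrix.mul_assoc]
  have eTF : T * Fᴴ = G * D * (W * Fᴴ) := by rw [hTdef]; simp only [Matrix.mul_assoc]
  rw [e, eFT, eTF]

end TwoLevel

/-! ## §2 The bound from the planted letters -/

section Bound

variable {m n : Type*} [Fintype m] [DecidableEq m] [Fintype n] [DecidableEq n]
variable {G D W : Matrix n n ℂ} {G' D' W' : Matrix m m ℂ} {J : Matrix m n ℂ}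

/-- **`opNorm_planted_word_sandwich_le` — THE ONE-STEP SANDWICH LAW OF `GDW` FROM THE TWO PLANTED LAWS AND A NESTED BOUNDED MULTIPLIER** [our proof]:
`‖G‖ ≤ g`, `‖D‖, ‖D′‖ ≤ α`, `‖W‖, ‖W′‖ ≤ κ`, `‖Ã‖, ‖J‖ ≤ 1`, `JᴴJ = 1`, `ÃJ = 1 + F`, `D′J = JD`, `‖G′ − JGJᴴ‖ ≤ p_G`, `‖W′ − JWJᴴ‖ ≤ p_W`, `‖FG‖ ≤ f`, `‖WFᴴ‖ ≤ f_W` ⟹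
`‖Ã(G′D′W′)Ãᴴ − GDW‖ ≤ ακ·p_G + gα·p_W + f·(ακ) + gα·f_W`.  The multiplier enters through its NORM and the NESTING only — no smoothness, no (H-bd), no (H-cons). -/
theorem opNorm_planted_word_sandwich_le {g α κ pG pW f fW : ℝ} (hG : ‖G‖ ≤ g) (hD : ‖D‖ ≤ α) (hD' : ‖D'‖ ≤ α) (hW : ‖W‖ ≤ κ) (hW' : ‖W'‖ ≤ κ)
    {At : Matrix n m ℂ} (hAt : ‖At‖ ≤ 1) (hJ : ‖J‖ ≤ 1) (hJJ : Jᴴ * J = 1) {F : Matrix n n ℂ} (hAJ : At * J = 1 + F) (hnest : D' * J = J * D)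
    (hpG : ‖G' - J * G * Jᴴ‖ ≤ pG) (hpW : ‖W' - J * W * Jᴴ‖ ≤ pW) (hF : ‖F * G‖ ≤ f) (hfW : ‖W * Fᴴ‖ ≤ fW) :
    ‖At * (G' * D' * W') * Atᴴ - G * D * W‖ ≤ α * κ * pG + g * α * pW + f * (α * κ) + g * α * fW := by
  have hg : 0 ≤ g := (norm_nonneg _).trans hG
  have hα : 0 ≤ α := (norm_nonneg _).trans hD
  have hκ : 0 ≤ κ := (norm_nonneg _).trans hW
  have hf : 0 ≤ f := (norm_nonneg _).trans hF
  have hpG0 : 0 ≤ pG := (norm_nonneg _).trans hpG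
  have hAt' : ‖Atᴴ‖ ≤ 1 := by rw [Matrix.l2_opNorm_conjTranspose]; exact hAt
  have hJ' : ‖Jᴴ‖ ≤ 1 := by rw [Matrix.l2_opNorm_conjTranspose]; exact hJ
  have hAJn : ‖(At * J)ᴴ‖ ≤ 1 := by
    rw [Matrix.l2_opNorm_conjTranspose]
    calc ‖At * J‖ ≤ ‖At‖ * ‖J‖ := Matrix.l2_opNorm_mul _ _
      _ ≤ 1 * 1 := mul_le_mul hAt hJ (norm_nonneg _) zero_le_one
      _ = 1 := one_mul 1
  have hGD : ‖G * D‖ ≤ g * α := (Matrix.l2_opNorm_mul _ _).trans (mul_le_mul hG hD (norm_nonneg _) hg)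
  have hDW : ‖D * W‖ ≤ α * κ := (Matrix.l2_opNorm_mul _ _).trans (mul_le_mul hD hW (norm_nonneg _) hα)
  have hD'W' : ‖D' * W'‖ ≤ α * κ := (Matrix.l2_opNorm_mul _ _).trans (mul_le_mul hD' hW' (norm_nonneg _) hα)
  have hJGJ : ‖J * G * Jᴴ‖ ≤ g := by
    calc ‖J * G * Jᴴ‖ ≤ ‖J * G‖ * ‖Jᴴ‖ := Matrix.l2_opNorm_mul _ _
      _ ≤ (‖J‖ * ‖G‖) * 1 := mul_le_mul (Matrix.l2_opNorm_mul _ _) hJ' (norm_nonneg _) (mul_nonneg (norm_nonneg _) (norm_nonneg _))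
      _ ≤ (1 * g) * 1 := mul_le_mul_of_nonneg_right (mul_le_mul hJ hG (norm_nonneg _) zero_le_one) zero_le_one
      _ = g := by ring
  have hJGJD : ‖J * G * Jᴴ * D'‖ ≤ g * α := (Matrix.l2_opNorm_mul _ _).trans (mul_le_mul hJGJ hD' (norm_nonneg _) hg)
  -- the planted defect of the word
  have hpl : ‖G' * D' * W' - J * (G * D * W) * Jᴴ‖ ≤ α * κ * pG + g * α * pW := by
    rw [planted_word_eq hJJ hnest]
    refine (norm_add_le _ _).trans (add_le_add ?_ ?_)
    · calc _ ≤ ‖G' - J * G * Jᴴ‖ * ‖D' * W'‖ := Matrix.l2_opNorm_mul _ _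
        _ ≤ pG * (α * κ) := mul_le_mul hpG hD'W' (norm_nonneg _) hpG0
        _ = α * κ * pG := by ring
    · exact (Matrix.l2_opNorm_mul _ _).trans (mul_le_mul hJGJD hpW (norm_nonneg _) (mul_nonneg hg hα))
  have hpl0 : 0 ≤ α * κ * pG + g * α * pW := (norm_nonneg _).trans hpl
  rw [sandwich_eq hAJ]
  refine (norm_add_le _ _).trans (add_le_add ((norm_add_le _ _).trans (add_le_add ?_ ?_)) ?_)
  · calc _ ≤ ‖At * (G' * D' * W' - J * (G * D * W) * Jᴴ)‖ * ‖Atᴴ‖ := Matrix.l2_opNorm_mul _ _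
      _ ≤ (‖At‖ * ‖G' * D' * W' - J * (G * D * W) * Jᴴ‖) * 1 := mul_le_mul (Matrix.l2_opNorm_mul _ _) hAt' (norm_nonneg _) (mul_nonneg (norm_nonneg _) (norm_nonneg _))
      _ ≤ (1 * (α * κ * pG + g * α * pW)) * 1 := mul_le_mul_of_nonneg_right (mul_le_mul hAt hpl (norm_nonneg _) zero_le_one) zero_le_one
      _ = α * κ * pG + g * α * pW := by ring
  · calc _ ≤ ‖F * G * (D * W)‖ * ‖(At * J)ᴴ‖ := Matrix.l2_opNorm_mul _ _
      _ ≤ (‖F * G‖ * ‖D * W‖) * 1 := mul_le_mul (Matrix.l2_opNorm_mul _ _) hAJn (norm_nonneg _) (mul_nonneg (norm_nonneg _) (norm_nonneg _))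
      _ ≤ (f * (α * κ)) * 1 := mul_le_mul_of_nonneg_right (mul_le_mul hF hDW (norm_nonneg _) hf) zero_le_one
      _ = f * (α * κ) := mul_one _
  · exact (Matrix.l2_opNorm_mul _ _).trans (mul_le_mul hGD hfW (norm_nonneg _) (mul_nonneg hg hα))

end Bound

/-! ## §3 Along a tower -/

section Tower

variable {ι : ℕ → Type*} [∀ k, Fintype (ι k)] [∀ k, DecidableEq (ι k)]
variable {Δ Dm W : (k : ℕ) → Matrix (ι k) (ι k) ℂ} {A : (k : ℕ) → Matrix (ι k) (ι (k + 1)) ℂ}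
  {J : (k : ℕ) → Matrix (ι (k + 1)) (ι k) ℂ} {F : (k : ℕ) → Matrix (ι k) (ι k) ℂ} {r g α κ : ℝ} {e₀ e₁ f pG pW fW : ℕ → ℝ}

/-- **`oneStepAveragedLaw_plantedWord` — THE ONE-STEP AVERAGED LAW OF `k ↦ Δ_k⁻¹D_kW_k` FROM THE PLANTED LETTERS** [our proof]: over `FreeTowerLaws Δ A J F r e₀ e₁ f`
(`Ã_k = √r·A_k`, `J_k`, `F_k`, the pairing defect `f`), with `J_kᴴJ_k = 1`, the nesting `D_{k+1}J_k = J_kD_k`, `‖Δ_k⁻¹‖ ≤ g`, `‖D_k‖ ≤ α`, `‖W_k‖ ≤ κ` and the DISPLAYED letters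
`‖Δ_{k+1}⁻¹ − J_kΔ_k⁻¹J_kᴴ‖ ≤ p_G k`, `‖W_{k+1} − J_kW_kJ_kᴴ‖ ≤ p_W k`, `‖W_kF_kᴴ‖ ≤ f_W k`:
`OneStepAveragedLaw A r (k ↦ Δ_k⁻¹D_kW_k) (k ↦ ακ·p_G k + gα·p_W k + f k·(ακ) + gα·f_W k)`. -/
theorem oneStepAveragedLaw_plantedWord (hr : 0 < r) (hfree : FreeTowerLaws Δ A J F r e₀ e₁ f) (hJJ : ∀ k, (J k)ᴴ * J k = 1)
    (hnest : ∀ k, Dm (k + 1) * J k = J k * Dm k) (hG : ∀ k, ‖(Δ k)⁻¹‖ ≤ g) (hD : ∀ k, ‖Dm k‖ ≤ α) (hW : ∀ k, ‖W k‖ ≤ κ)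
    (hpG : ∀ k, ‖(Δ (k + 1))⁻¹ - J k * (Δ k)⁻¹ * (J k)ᴴ‖ ≤ pG k) (hpW : ∀ k, ‖W (k + 1) - J k * W k * (J k)ᴴ‖ ≤ pW k)
    (hfW : ∀ k, ‖W k * (F k)ᴴ‖ ≤ fW k) :
    OneStepAveragedLaw A r (fun k => (Δ k)⁻¹ * Dm k * W k) (fun k => α * κ * pG k + g * α * pW k + f k * (α * κ) + g * α * fW k) := by
  intro k
  have hs0 : 0 < Real.sqrt r := Real.sqrt_pos.mpr hr
  set At : Matrix (ι k) (ι (k + 1)) ℂ := (((Real.sqrt r : ℝ) : ℂ)) • A k with hAt_def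
  have hAt : ‖At‖ ≤ 1 := opNorm_normalised_le hr (hfree.opNorm_A_sq_le k)
  have hAJ : At * J k = 1 + F k := by rw [hAt_def, Matrix.smul_mul]; exact hfree.A_mul_J k
  have key := opNorm_planted_word_sandwich_le (G := (Δ k)⁻¹) (G' := (Δ (k + 1))⁻¹) (D := Dm k) (D' := Dm (k + 1)) (W := W k) (W' := W (k + 1)) (J := J k)
    (hG k) (hD k) (hD (k + 1)) (hW k) (hW (k + 1)) hAt (hfree.opNorm_J_le k) (hJJ k) hAJ (hnest k) (hpG k) (hpW k) (hfree.opNorm_F_mul_inv_le k) (hfW k)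
  have hss : star ((((Real.sqrt r : ℝ) : ℂ))) = (((Real.sqrt r : ℝ) : ℂ)) := Complex.conj_ofReal _
  have hsq : ((((Real.sqrt r : ℝ) : ℂ))) * (((Real.sqrt r : ℝ) : ℂ)) = (r : ℂ) := by
    rw [← Complex.ofReal_mul, Real.mul_self_sqrt hr.le]
  have hrC : (r : ℂ) ≠ 0 := by exact_mod_cast hr.ne'
  have e : A k * ((Δ (k + 1))⁻¹ * Dm (k + 1) * W (k + 1)) * (A k)ᴴ - ((r : ℂ))⁻¹ • ((Δ k)⁻¹ * Dm k * W k)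
      = ((r : ℂ))⁻¹ • (At * ((Δ (k + 1))⁻¹ * Dm (k + 1) * W (k + 1)) * Atᴴ - (Δ k)⁻¹ * Dm k * W k) := by
    rw [hAt_def, Matrix.conjTranspose_smul, hss, Matrix.smul_mul, Matrix.smul_mul, Matrix.mul_smul, smul_smul, hsq, smul_sub, smul_smul,
      inv_mul_cancel₀ hrC, one_smul]
  rw [e, norm_smul, norm_inv, Complex.norm_real, Real.norm_of_nonneg hr.le]
  exact mul_le_mul_of_nonneg_left key (inv_nonneg.mpr hr.le)

/-- **`towerLimitRate_plantedWord` — THE TOWER LIMIT WITH RATE FOR THE WORD WITH A NESTED BOUNDED MULTIPLIER, FROM GEOMETRIC PLANTED LETTERS** [our proof]: if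
`p_G k ≤ C_Gρ^k`, `p_W k ≤ C_Wρ^k`, `f k ≤ C_fρ^k`, `f_W k ≤ C_{fW}ρ^k` with `ρ < 1`, then `TowerLimitRate A r (k ↦ Δ_k⁻¹D_kW_k) (ακC_G + gαC_W + ακC_f + gαC_{fW}) ρ`: the
unit-lattice images of the word converge with rate `ρ^k` — for a multiplier that is merely BOUNDED and NESTED. -/
theorem towerLimitRate_plantedWord (hr : 0 < r) (hfree : FreeTowerLaws Δ A J F r e₀ e₁ f) (hJJ : ∀ k, (J k)ᴴ * J k = 1)
    (hnest : ∀ k, Dm (k + 1) * J k = J k * Dm k) (hG : ∀ k, ‖(Δ k)⁻¹‖ ≤ g) (hD : ∀ k, ‖Dm k‖ ≤ α) (hW : ∀ k, ‖W k‖ ≤ κ)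
    (hpG : ∀ k, ‖(Δ (k + 1))⁻¹ - J k * (Δ k)⁻¹ * (J k)ᴴ‖ ≤ pG k) (hpW : ∀ k, ‖W (k + 1) - J k * W k * (J k)ᴴ‖ ≤ pW k)
    (hfW : ∀ k, ‖W k * (F k)ᴴ‖ ≤ fW k)
    {ρ CG CW Cf CfW : ℝ} (hρ1 : ρ < 1) (hcG : ∀ k, pG k ≤ CG * ρ ^ k) (hcW : ∀ k, pW k ≤ CW * ρ ^ k) (hcf : ∀ k, f k ≤ Cf * ρ ^ k) (hcfW : ∀ k, fW k ≤ CfW * ρ ^ k) :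
    TowerLimitRate A r (fun k => (Δ k)⁻¹ * Dm k * W k) (α * κ * CG + g * α * CW + α * κ * Cf + g * α * CfW) ρ := by
  have hg : 0 ≤ g := (norm_nonneg _).trans (hG 0)
  have hα : 0 ≤ α := (norm_nonneg _).trans (hD 0)
  have hκ : 0 ≤ κ := (norm_nonneg _).trans (hW 0)
  have hlaw : OneStepAveragedLaw A r (fun k => (Δ k)⁻¹ * Dm k * W k) (fun k => (α * κ * CG + g * α * CW + α * κ * Cf + g * α * CfW) * ρ ^ k) := by
    intro k
    refine (oneStepAveragedLaw_plantedWord hr hfree hJJ hnest hG hD hW hpG hpW hfW k).trans (mul_le_mul_of_nonneg_left ?_ (inv_nonneg.mpr hr.le))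
    have hgα : 0 ≤ g * α := mul_nonneg hg hα
    have hακ : 0 ≤ α * κ := mul_nonneg hα hκ
    have a1 : α * κ * pG k ≤ α * κ * (CG * ρ ^ k) := mul_le_mul_of_nonneg_left (hcG k) hακ
    have a2 : g * α * pW k ≤ g * α * (CW * ρ ^ k) := mul_le_mul_of_nonneg_left (hcW k) hgα
    have a3 : f k * (α * κ) ≤ (Cf * ρ ^ k) * (α * κ) := mul_le_mul_of_nonneg_right (hcf k) hακ
    have a4 : g * α * fW k ≤ g * α * (CfW * ρ ^ k) := mul_le_mul_of_nonneg_left (hcfW k) hgα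
    nlinarith [a1, a2, a3, a4]
  exact towerLimitRate_of_oneStepAveragedLaw A hr hfree.opNorm_A_sq_le _ hρ1 hlaw

end Tower

end Summit.QuantumFields.BalabanUV.Beta.GAN24.PlantedWordLaw

end
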